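import Summits.CriticalPhenomena.PercolationContinuityZ3.Theorems.PercNearOneGluingNoHeavyQuantFlowPieces
import Summits.CriticalPhenomena.PercolationContinuityZ3.Theorems.PercNearOneGluingNoHeavyQuantLawDecUsageMonge
import Summits.CriticalPhenomena.PercolationContinuityZ3.Theorems.PercNearOneGluingNoHeavyQuantLawDecFlowsDecomposition
import HarnessLib

/-!
# QUANT lane R8, T-DEC: THE INCOME CRITERION — DEC at a target as ONE budget inequality for the routing of the NONZERO lows
# (the zero atom eliminated by the first-moment identity): `flowAtT_of_offers`, `flowAtT_of_income`, `decAtT_of_income`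

builds on p205010 (kernel theorem, internal audit signed; external expert review pending)

Support file (`--supports stmt-CriticalPhenomena-4575`), QUANT lane seat prim-quant-arm-1 (gen 39), rung R8 of
`run/shared/lean/prim/quant/LADDER.md`.  Theorems only (no definitions), standard axioms, no sorries.  Generalises typer g26's
`LawDec.flowAtT_of_moment` (`…QuantFlowPieces`: the case with NO charged nonzero low) and packages typer g27's remainder bookkeeping
(`…QuantGateMoveBlob`: partial flow into mids, then moment criterion OR criterion E) into a single finishing move that interpolates between
the two: nonzero lows may be PARTLY placed into mids and PARTLY shipped to the giants, and the zero atom is then served from what is left,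
at the exact rates (`T/(m − T)` at a mid `m > T`, `x/(1−x)` at a giant).  Memo `run/shared/lean/prim/quant/prim-quant-arm-1-g39/TWIN-MOVE-G39.md` §3.

THE CRITERION.  Law `A ≥ 0` on `{0..M}` (not normalised), floor `0 < x < 1`, target `T > 0`, layer `j′`, mids heavy for the zero
(`x·m ≤ T` for every mid `m > T`).  Let `φ ≥ 0` route EVERY nonzero low `l` (`1 ≤ l ≤ j′`, `2l < T`) completely into compatible absorbers
(mids `m ≤ j′` with `T < l + m`, at the usage rates `LawDec.usage`; giants `h ≥ j′+1` at rate `x/(1−x)`) within their capacities.  Then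
`A` has a flow at `(x, T, j′)` as soon as the ZERO atom fits into the leftover capacity at its own rates (`flowAtT_of_offers`):
`T·A 0 ≤ Σ_{mids m > T} (m − T)·(A m − load m) + Σ_{giants h} T(1−x)/x·(A h − load h)`.
With the first-moment inequality `T·Σ A ≤ Σ h·A h` this is the INCOME form (`flowAtT_of_income`):
`COST := Σ_{mids m > T} (m − T)·load m + T·W ≤ INCOME := Σ_{1 ≤ h ≤ j′, h < T} (T − h)·A h + Σ_{giants h} (T − x h)/x·A h`,
`W` = the nonzero low mass shipped to the giants (`T(1−x)/x·load` at a giant is `T` per unit of low mass).  Reading: every nonzero atom below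
the target brings income `T − h` (lows AND self-sufficient low mids), every giant brings its top-affordability slack `(T − xh)/x`; a unit of a
low `l` placed into a mid `m > T` costs `usage·(m − T) ≤ T − l` (`usage_mid_mul_le`: mid pairs never run a deficit), into a mid `m ≤ T`
costs nothing, shipped to a giant costs `T` (a deficit of exactly `l` against its income).  So DEC at `(x, T, j′)` holds as soon as the
giant-routed nonzero lows' deficit `Σ l·W_l` is covered by the mid-pair slacks, the low-mid incomes and the giants' slack — the typer's
dichotomy (everything placed ⟹ moment criterion; nothing placed ⟹ criterion E for zero + unplaced) are its two ends.  By LP duality the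
criterion is also necessary (min-cost routing; exact check `code/income.py`, 400/400 against the DEC LP); only sufficiency is proved here.

* `LawDec.flowAtT_of_offers` — partial routing of all nonzero lows + the zero's offer inequality ⟹ `FlowAtT`.
* `LawDec.flowAtT_of_income` — the same with the offer inequality replaced by the moment inequality + `COST ≤ INCOME`.
* `LawDec.decAtT_of_income` — the `DECAtT` form for a probability law (`decAtT_of_flowAtT`).

[this work]; flow form / partial flows / moment criterion: prim-quant-stmt g26–g27 (this lane).  Nothing here is cited as a published
result.  The gluing rows served [cite: KozmaNitzan2024, Conjecture 3 (p. 15)]; product measure [cite: Grimmett1999, §1.3 p. 10].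
-/

noncomputable section

namespace Summit.CriticalPhenomena.PercolationContinuityZ3.Theorems

namespace Quant

open Finset

namespace LawDec

/-- **THE INCOME CRITERION, OFFER FORM.**  `A ≥ 0`, `0 < x < 1`, `0 < T`; every mid `m ≤ j′`, `m ≤ M` above the target is heavy for the
zero (`x·m ≤ T`); `φ ≥ 0` charges only pairs (nonzero low `l`, compatible absorber `h ≤ M`), routes every nonzero low completely and loads
every absorber by at most its mass.  If `T·A 0 ≤ Σ_{h ≤ M} κ_h·(A h − load h)` with `κ_h = T(1−x)/x` for a giant, `h − T` for a mid
`h > T`, `0` otherwise, then `FlowAtT x T j′ M A`: the zero atom is spread over the leftover capacities proportionally to these offers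
(`isFlowAtT_of_partial` + the witness of `flowAtT_of_moment` at the exact giant rate). [this work] -/
theorem flowAtT_of_offers (x T : ℝ) (j' M : ℕ) (A : ℕ → ℝ) (φ : ℕ → ℕ → ℝ) (hx0 : 0 < x) (hx1 : x < 1) (hT : 0 < T)
    (hA0 : ∀ h, 0 ≤ A h)
    (hta : ∀ h : ℕ, h ≤ j' → h ≤ M → T < (h : ℝ) → x * (h : ℝ) ≤ T)
    (hφ0 : ∀ l h, 0 ≤ φ l h)
    (hφsupp : ∀ l h, 0 < φ l h → (1 ≤ l ∧ l ≤ j' ∧ 2 * (l : ℝ) < T) ∧ h ≤ M ∧ (j' + 1 ≤ h ∨ T < (l : ℝ) + h))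
    (hφrow : ∀ l : ℕ, 1 ≤ l → l ≤ j' → 2 * (l : ℝ) < T → ∑ h ∈ Finset.range (M + 1), φ l h = A l)
    (hφcol : ∀ h, h ≤ M → (j' + 1 ≤ h ∨ T ≤ 2 * (h : ℝ)) → ∑ l ∈ Finset.range (j' + 1), usage x T j' l h * φ l h ≤ A h)
    (hoffer : T * A 0 ≤ ∑ h ∈ Finset.range (M + 1),
      (if j' + 1 ≤ h then T * (1 - x) / x else if T < (h : ℝ) then (h : ℝ) - T else 0)
        * (A h - ∑ l ∈ Finset.range (j' + 1), usage x T j' l h * φ l h)) :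
    FlowAtT x T j' M A := by
  classical
  have h1x : 0 < 1 - x := by linarith
  -- the remainder after the partial routing
  set Rem : ℕ → ℝ := fun t => A t - ∑ h ∈ Finset.range (M + 1), φ t h - ∑ l ∈ Finset.range (j' + 1), usage x T j' l t * φ l t
    with hRem
  -- `φ` ships nothing out of the zero atom and nothing into it
  have hφzero_out : ∀ h, φ 0 h = 0 := by
    intro h
    by_contra hne
    have := (hφsupp 0 h (lt_of_le_of_ne (hφ0 0 h) (Ne.symm hne))).1.1
    omega
  have hφzero_in : ∀ l, φ l 0 = 0 := by
    intro l
    by_contra hne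
    obtain ⟨⟨_, _, hl2⟩, _, hc⟩ := hφsupp l 0 (lt_of_le_of_ne (hφ0 l 0) (Ne.symm hne))
    rcases hc with hc | hc
    · omega
    · simp only [Nat.cast_zero, add_zero] at hc
      have : (0 : ℝ) ≤ l := Nat.cast_nonneg l
      linarith
  have hRem0 : Rem 0 = A 0 := by
    simp only [hRem]
    rw [Finset.sum_eq_zero (fun h _ => hφzero_out h), Finset.sum_eq_zero (fun l _ => by rw [hφzero_in l, mul_zero])]
    ring
  -- an absorber ships nothing
  have hout : ∀ t h, (j' + 1 ≤ t ∨ T ≤ 2 * (t : ℝ)) → φ t h = 0 := by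
    intro t h habs
    by_contra hne
    obtain ⟨⟨_, htj, htlow⟩, _, _⟩ := hφsupp t h (lt_of_le_of_ne (hφ0 t h) (Ne.symm hne))
    rcases habs with h1 | h2
    · omega
    · linarith
  have hRemAbs : ∀ h, (j' + 1 ≤ h ∨ T ≤ 2 * (h : ℝ)) →
      Rem h = A h - ∑ l ∈ Finset.range (j' + 1), usage x T j' l h * φ l h := by
    intro h habs
    simp only [hRem]
    rw [Finset.sum_eq_zero (fun h' _ => hout h h' habs)]
    ring
  have hRemAbs0 : ∀ h, h ≤ M → (j' + 1 ≤ h ∨ T ≤ 2 * (h : ℝ)) → 0 ≤ Rem h := by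
    intro h hhM habs
    rw [hRemAbs h habs]
    linarith [hφcol h hhM habs]
  -- the offers (in units of zero mass)
  set κ : ℕ → ℝ := fun h => if j' + 1 ≤ h then (1 - x) / x else if T < (h : ℝ) then ((h : ℝ) - T) / T else 0 with hκ
  set c : ℕ → ℝ := fun h => if h ≤ M then κ h * Rem h else 0 with hc
  set Tot : ℝ := ∑ h ∈ Finset.range (M + 1), c h with hTot
  have hκ0 : ∀ h, 0 ≤ κ h := fun h => by
    simp only [hκ]
    split_ifs with h1 h2
    · exact div_nonneg h1x.le hx0.le
    · exact div_nonneg (by linarith) hT.le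
    · exact le_rfl
  -- an atom with a positive offer coefficient is an absorber compatible with the zero
  have hκabs : ∀ h, κ h ≠ 0 → (j' + 1 ≤ h ∨ T ≤ 2 * (h : ℝ)) ∧ (j' + 1 ≤ h ∨ T < (h : ℝ)) := by
    intro h hk
    simp only [hκ] at hk
    by_cases h1 : j' + 1 ≤ h
    · exact ⟨Or.inl h1, Or.inl h1⟩
    · rw [if_neg h1] at hk
      by_cases h2 : T < (h : ℝ)
      · refine ⟨Or.inr ?_, Or.inr h2⟩
        have : (0 : ℝ) ≤ h := Nat.cast_nonneg h
        linarith
      · rw [if_neg h2] at hk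
        exact absurd rfl hk
  have hc0 : ∀ h, 0 ≤ c h := fun h => by
    simp only [hc]
    split_ifs with hhM
    · by_cases hk : κ h = 0
      · rw [hk, zero_mul]
      · exact mul_nonneg (hκ0 h) (hRemAbs0 h hhM (hκabs h hk).1)
    · exact le_rfl
  have hTot0 : 0 ≤ Tot := Finset.sum_nonneg fun h _ => hc0 h
  -- the offers cover the zero atom
  have hTotA : A 0 ≤ Tot := by
    have e : ∀ h ∈ Finset.range (M + 1),
        (if j' + 1 ≤ h then T * (1 - x) / x else if T < (h : ℝ) then (h : ℝ) - T else 0)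
          * (A h - ∑ l ∈ Finset.range (j' + 1), usage x T j' l h * φ l h) = T * c h := by
      intro h hh
      rw [Finset.mem_range] at hh
      have hhM : h ≤ M := by omega
      simp only [hc, if_pos hhM, hκ]
      by_cases h1 : j' + 1 ≤ h
      · rw [if_pos h1, if_pos h1, hRemAbs h (Or.inl h1)]
        field_simp
      · rw [if_neg h1, if_neg h1]
        by_cases h2 : T < (h : ℝ)
        · rw [if_pos h2, if_pos h2, hRemAbs h (Or.inr (by have : (0:ℝ) ≤ h := Nat.cast_nonneg h; linarith))]
          field_simp
        · rw [if_neg h2, if_neg h2]; ring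
    rw [Finset.sum_congr rfl e, ← Finset.mul_sum] at hoffer
    exact le_of_mul_le_mul_left hoffer hT
  have hfrac : A 0 / Tot ≤ 1 := by
    by_cases hT0 : Tot = 0
    · rw [hT0, div_zero]; exact zero_le_one
    · exact (div_le_one (lt_of_le_of_ne hTot0 (Ne.symm hT0))).2 hTotA
  have hfrac0 : 0 ≤ A 0 / Tot := div_nonneg (hA0 0) hTot0
  -- the zero's flow on the remainder
  set g : ℕ → ℕ → ℝ := fun l h => if l = 0 then A 0 * c h / Tot else 0 with hg
  have hgflow : IsFlowAtT x T j' M Rem g := by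
    refine ⟨fun l h => ?_, fun l h hp => ?_, fun l hl hlow => ?_, fun h hhM habs => ?_⟩
    · simp only [hg]
      split_ifs
      · exact div_nonneg (mul_nonneg (hA0 0) (hc0 h)) hTot0
      · exact le_rfl
    · by_cases hl0 : l = 0
      · subst hl0
        simp only [hg, if_true] at hp
        have hch : c h ≠ 0 := by
          intro hz; rw [hz, mul_zero, zero_div] at hp; exact lt_irrefl _ hp
        have hhM : h ≤ M := by
          by_contra hn; simp only [hc, if_neg hn] at hch; exact hch rfl
        have hk : κ h ≠ 0 := by
          intro hz; simp only [hc, if_pos hhM, hz, zero_mul] at hch; exact hch rfl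
        refine ⟨Nat.zero_le _, by simpa using hT, hhM, ?_⟩
        simpa using (hκabs h hk).2
      · simp only [hg, if_neg hl0] at hp
        exact absurd hp (lt_irrefl 0)
    · by_cases hl0 : l = 0
      · subst hl0
        simp only [hg, if_true]
        rw [← Finset.sum_div, ← Finset.mul_sum, ← hTot, hRem0]
        by_cases hT0 : Tot = 0
        · have hA00 : A 0 = 0 := le_antisymm (by rw [hT0] at hTotA; exact hTotA) (hA0 0)
          rw [hT0, hA00]; simp
        · field_simp
      · have h1 : 1 ≤ l := Nat.one_le_iff_ne_zero.2 hl0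
        simp only [hg, if_neg hl0, Finset.sum_const_zero]
        -- a nonzero low is fully routed: its remainder vanishes
        simp only [hRem]
        rw [hφrow l h1 hl hlow]
        have hz : ∑ l' ∈ Finset.range (j' + 1), usage x T j' l' l * φ l' l = 0 := by
          refine Finset.sum_eq_zero fun l' _ => ?_
          by_cases hne : φ l' l = 0
          · rw [hne, mul_zero]
          · exfalso
            obtain ⟨_, _, hc'⟩ := hφsupp l' l (lt_of_le_of_ne (hφ0 l' l) (Ne.symm hne))
            rcases hc' with hc' | hc'
            · omega
            · have : (0 : ℝ) ≤ l' := Nat.cast_nonneg l'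
              linarith
        rw [hz]; ring
    · rw [Finset.sum_eq_single 0 (fun l _ hl0 => by simp only [hg, if_neg hl0, mul_zero])
        (fun h0 => absurd (Finset.mem_range.2 (Nat.succ_pos j')) h0)]
      simp only [hg, if_true]
      have hR0 : 0 ≤ Rem h := hRemAbs0 h hhM habs
      simp only [hc, if_pos hhM]
      by_cases hk : κ h = 0
      · rw [hk, zero_mul, mul_zero, zero_div, mul_zero]; exact hR0
      have hcomp := (hκabs h hk).2
      have hu0 : 0 ≤ usage x T j' 0 h := by
        have hhpos : 0 < h := by
          rcases hcomp with h1 | h2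
          · omega
          · have : (0 : ℝ) < h := lt_trans hT h2
            exact_mod_cast this
        exact (usage_pos_of_compat x T j' 0 h hx0 hx1 (by simpa using hT) hhpos (by simpa using hcomp)).le
      -- `usage(0,h)·κ_h ≤ 1`
      have hunit : usage x T j' 0 h * κ h ≤ 1 := by
        simp only [hκ]
        by_cases h1 : j' + 1 ≤ h
        · rw [if_pos h1, usage_giant_eq x T j' 0 h h1]
          have : x / (1 - x) * ((1 - x) / x) = 1 := by field_simp
          rw [this]
        · rw [if_neg h1]
          have h2 : T < (h : ℝ) := hcomp.resolve_left h1
          rw [if_pos h2]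
          have hxh : x * (h : ℝ) ≤ T := hta h (by omega) hhM h2
          have hu := usage_zero_mul_le x T j' h hx0 hx1 hT (Or.inr h2) hxh
          rw [← mul_div_assoc, div_le_one hT]
          exact hu
      calc usage x T j' 0 h * (A 0 * (κ h * Rem h) / Tot)
          = (A 0 / Tot) * ((usage x T j' 0 h * κ h) * Rem h) := by ring
        _ ≤ 1 * (1 * Rem h) :=
            mul_le_mul hfrac (mul_le_mul_of_nonneg_right hunit hR0)
              (mul_nonneg (mul_nonneg hu0 (hκ0 h)) hR0) zero_le_one
        _ = Rem h := by ring
  -- assemble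
  have hsupp' : ∀ l h, 0 < φ l h → l ≤ j' ∧ 2 * (l : ℝ) < T ∧ h ≤ M ∧ (j' + 1 ≤ h ∨ T < (l : ℝ) + h) := by
    intro l h hp
    obtain ⟨⟨_, hlj, hl2⟩, hhM, hcomp⟩ := hφsupp l h hp
    exact ⟨hlj, hl2, hhM, hcomp⟩
  exact (flowAtT_iff_exists_isFlowAtT x T j' M A).2 ⟨_, isFlowAtT_of_partial hφ0 hsupp' hgflow⟩

/-- **THE INCOME CRITERION.**  Data as in `flowAtT_of_offers`, with the offer inequality replaced by the first-moment inequality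
`T·Σ_{h ≤ M} A h ≤ Σ_{h ≤ M} h·A h` and the budget inequality `COST ≤ INCOME`:
`Σ_{h ≤ M} c_h·load h ≤ Σ_{h ≤ M} i_h·A h`, where `load h = Σ_l usage(l,h)·φ l h`, the cost coefficients are `c_h = T(1−x)/x` for a giant
(`= T` per unit of low mass shipped there), `h − T` for a mid `h > T`, `0` otherwise, and the income coefficients are `i_h = (T − xh)/x` for a
giant, `T − h` for `1 ≤ h ≤ j′` with `h < T`, `0` otherwise. [this work] -/
theorem flowAtT_of_income (x T : ℝ) (j' M : ℕ) (A : ℕ → ℝ) (φ : ℕ → ℕ → ℝ) (hx0 : 0 < x) (hx1 : x < 1) (hT : 0 < T)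
    (hA0 : ∀ h, 0 ≤ A h)
    (hta : ∀ h : ℕ, h ≤ j' → h ≤ M → T < (h : ℝ) → x * (h : ℝ) ≤ T)
    (hφ0 : ∀ l h, 0 ≤ φ l h)
    (hφsupp : ∀ l h, 0 < φ l h → (1 ≤ l ∧ l ≤ j' ∧ 2 * (l : ℝ) < T) ∧ h ≤ M ∧ (j' + 1 ≤ h ∨ T < (l : ℝ) + h))
    (hφrow : ∀ l : ℕ, 1 ≤ l → l ≤ j' → 2 * (l : ℝ) < T → ∑ h ∈ Finset.range (M + 1), φ l h = A l)
    (hφcol : ∀ h, h ≤ M → (j' + 1 ≤ h ∨ T ≤ 2 * (h : ℝ)) → ∑ l ∈ Finset.range (j' + 1), usage x T j' l h * φ l h ≤ A h)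
    (hmom : T * ∑ h ∈ Finset.range (M + 1), A h ≤ ∑ h ∈ Finset.range (M + 1), (h : ℝ) * A h)
    (hinc : ∑ h ∈ Finset.range (M + 1),
        (if j' + 1 ≤ h then T * (1 - x) / x else if T < (h : ℝ) then (h : ℝ) - T else 0)
          * ∑ l ∈ Finset.range (j' + 1), usage x T j' l h * φ l h
      ≤ ∑ h ∈ Finset.range (M + 1),
        (if j' + 1 ≤ h then (T - x * (h : ℝ)) / x else if (1 ≤ h ∧ (h : ℝ) < T) then T - (h : ℝ) else 0) * A h) :
    FlowAtT x T j' M A := by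
  refine flowAtT_of_offers x T j' M A φ hx0 hx1 hT hA0 hta hφ0 hφsupp hφrow hφcol ?_
  -- `T·A 0 ≤ Σ_{h ≥ 1} (h − T)·A h` from the moment inequality
  have hmom' : T * A 0 ≤ ∑ h ∈ Finset.range (M + 1), (if h = 0 then 0 else ((h : ℝ) - T) * A h) := by
    have e : ∀ h : ℕ, ((h : ℝ) - T) * A h
        = (if h = 0 then 0 else ((h : ℝ) - T) * A h) + (if h = 0 then -(T * A 0) else 0) := by
      intro h
      by_cases h0 : h = 0
      · subst h0; simp
      · rw [if_neg h0, if_neg h0, add_zero]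
    have hnn : 0 ≤ ∑ h ∈ Finset.range (M + 1), ((h : ℝ) - T) * A h := by
      have e2 : ∑ h ∈ Finset.range (M + 1), ((h : ℝ) - T) * A h
          = ∑ h ∈ Finset.range (M + 1), (h : ℝ) * A h - T * ∑ h ∈ Finset.range (M + 1), A h := by
        rw [Finset.mul_sum, ← Finset.sum_sub_distrib]
        exact Finset.sum_congr rfl fun h _ => by ring
      rw [e2]; linarith
    rw [Finset.sum_congr rfl (fun h _ => e h), Finset.sum_add_distrib, Finset.sum_ite_eq' (Finset.range (M + 1)) 0,
      if_pos (Finset.mem_range.2 (Nat.succ_pos M))] at hnn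
    linarith
  refine hmom'.trans ?_
  -- compare coefficient by coefficient after moving the loads to the income side
  have key : ∀ h ∈ Finset.range (M + 1),
      (if h = 0 then 0 else ((h : ℝ) - T) * A h)
        + (if j' + 1 ≤ h then (T - x * (h : ℝ)) / x else if (1 ≤ h ∧ (h : ℝ) < T) then T - (h : ℝ) else 0) * A h
        - (if j' + 1 ≤ h then T * (1 - x) / x else if T < (h : ℝ) then (h : ℝ) - T else 0)
          * ∑ l ∈ Finset.range (j' + 1), usage x T j' l h * φ l h
      ≤ (if j' + 1 ≤ h then T * (1 - x) / x else if T < (h : ℝ) then (h : ℝ) - T else 0)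
        * (A h - ∑ l ∈ Finset.range (j' + 1), usage x T j' l h * φ l h) := by
    intro h hh
    by_cases h1 : j' + 1 ≤ h
    · have h0 : h ≠ 0 := by omega
      simp only [if_neg h0, if_pos h1]
      have e : ((h : ℝ) - T) * A h + (T - x * (h : ℝ)) / x * A h = T * (1 - x) / x * A h := by
        field_simp
        ring
      have e2 : T * (1 - x) / x * (A h - ∑ l ∈ Finset.range (j' + 1), usage x T j' l h * φ l h)
          = T * (1 - x) / x * A h - T * (1 - x) / x * ∑ l ∈ Finset.range (j' + 1), usage x T j' l h * φ l h :=
        mul_sub _ _ _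
      rw [e2]
      linarith [e]
    · simp only [if_neg h1]
      by_cases h0 : h = 0
      · subst h0
        rw [if_pos rfl, if_neg (by simp), if_neg (by simpa using hT.le)]
        simp
      · rw [if_neg h0]
        have h1' : 1 ≤ h := Nat.one_le_iff_ne_zero.2 h0
        by_cases hlt : (h : ℝ) < T
        · rw [if_pos ⟨h1', hlt⟩, if_neg (by linarith)]
          have : ((h : ℝ) - T) * A h + (T - (h : ℝ)) * A h = 0 := by ring
          linarith
        · rw [if_neg (fun hc => hlt hc.2)]
          by_cases hgt : T < (h : ℝ)
          · rw [if_pos hgt]; linarith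
          · rw [if_neg hgt]
            have heq : (h : ℝ) = T := le_antisymm (not_lt.1 hgt) (not_lt.1 hlt)
            rw [heq]; simp
  have hsum := Finset.sum_le_sum key
  rw [Finset.sum_sub_distrib, Finset.sum_add_distrib] at hsum
  linarith

/-- **THE INCOME CRITERION FOR DEC.**  For a probability law `A` on `{0..M}` (vanishing above `M`, mass `1`) the data of
`flowAtT_of_income` give `DECAtT x T j′ M A` (`decAtT_of_flowAtT`). [this work] -/
theorem decAtT_of_income (x T : ℝ) (j' M : ℕ) (A : ℕ → ℝ) (φ : ℕ → ℕ → ℝ) (hx0 : 0 < x) (hx1 : x < 1) (hT : 0 < T)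
    (hA0 : ∀ h, 0 ≤ A h) (hAM : ∀ h, M < h → A h = 0) (hA1 : ∑ h ∈ Finset.range (M + 1), A h = 1)
    (hta : ∀ h : ℕ, h ≤ j' → h ≤ M → T < (h : ℝ) → x * (h : ℝ) ≤ T)
    (hφ0 : ∀ l h, 0 ≤ φ l h)
    (hφsupp : ∀ l h, 0 < φ l h → (1 ≤ l ∧ l ≤ j' ∧ 2 * (l : ℝ) < T) ∧ h ≤ M ∧ (j' + 1 ≤ h ∨ T < (l : ℝ) + h))
    (hφrow : ∀ l : ℕ, 1 ≤ l → l ≤ j' → 2 * (l : ℝ) < T → ∑ h ∈ Finset.range (M + 1), φ l h = A l)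
    (hφcol : ∀ h, h ≤ M → (j' + 1 ≤ h ∨ T ≤ 2 * (h : ℝ)) → ∑ l ∈ Finset.range (j' + 1), usage x T j' l h * φ l h ≤ A h)
    (hmom : T * ∑ h ∈ Finset.range (M + 1), A h ≤ ∑ h ∈ Finset.range (M + 1), (h : ℝ) * A h)
    (hinc : ∑ h ∈ Finset.range (M + 1),
        (if j' + 1 ≤ h then T * (1 - x) / x else if T < (h : ℝ) then (h : ℝ) - T else 0)
          * ∑ l ∈ Finset.range (j' + 1), usage x T j' l h * φ l h
      ≤ ∑ h ∈ Finset.range (M + 1),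
        (if j' + 1 ≤ h then (T - x * (h : ℝ)) / x else if (1 ≤ h ∧ (h : ℝ) < T) then T - (h : ℝ) else 0) * A h) :
    DECAtT x T j' M A :=
  decAtT_of_flowAtT x T j' M A hx0 hx1 hAM hA1
    (flowAtT_of_income x T j' M A φ hx0 hx1 hT hA0 hta hφ0 hφsupp hφrow hφcol hmom hinc)

end LawDec

end Quant

end Summit.CriticalPhenomena.PercolationContinuityZ3.Theorems
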